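import Mathlib
import Literature.MeasureTheory.Integral.HausdorffMomentBernsteinIdentity
import Literature.MeasureTheory.Integral.HausdorffMomentBernsteinLimit
import Literature.MeasureTheory.Integral.MomentsWeakCompactness
import Literature.MeasureTheory.Integral.HankelContraction
import Literature.MeasureTheory.Integral.HankelCompletelyMonotone

/-!
# Hausdorff's moment theorem, and `[0,1]`-moment sequences from double Hankel positivity

Two classical characterisations of the Hausdorff moment sequences `a n = ∫_{[0,1]} tⁿ dμ(t)`
(`μ` a finite positive measure):

* `hausdorffMoment_iff_alternating` (Hausdorff 1921; Berg–Christensen–Ressel 1984, Ch. 4,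
  Prop. 6.11): `a` is a `[0,1]`-moment sequence iff it is COMPLETELY MONOTONE,
  `∑_{i ≤ k} (-1)^i C(k,i) a(n+i) ≥ 0` for all `n, k`. The hard direction is Hausdorff's
  construction: the Bernstein weights `λ_{N,j} = C(N,j) (-Δ)^{N-j} a_j ≥ 0` carry the exact
  "descending-factorial moments" `a n` (`bernsteinWeights_sum_descFactorial`), their ordinary moments
  `∑_j (j/N)ⁿ λ_{N,j}` tend to `a n` (`bernsteinWeights_moment_tendsto`), and weak compactness on
  `[0,1]` produces `μ` (`exists_measure_of_discreteMoments_tendsto`).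
* `hausdorffMoment_of_hankel_posSemidef` (Berg–Christensen–Ressel 1984, Ch. 4, Prop. 4.9 with
  Ch. 6, Thm. 2.5; Hamburger 1920 / Hausdorff 1921): a BOUNDED real sequence whose two Hankel forms
  `(i,j) ↦ a(i+j)` and `(i,j) ↦ a(i+j+1)` are positive semidefinite is a `[0,1]`-moment sequence —
  the shift contracts by Cauchy–Schwarz (`hankel_shift_abs_le`, applied to `a` and to `a(·+1)`), which
  gives the four square-positivities from which complete monotonicity follows
  (`hankel_alternating`).

The second form is the one reflection positivity produces: for lattice correlations, positivity of
`⟨ΘF · F⟩` over configurations at even resp. odd heights above a mirror is exactly positive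
semidefiniteness of the two Hankel forms of the sequence of mirror-time translates, and `|⟨σσ⟩| ≤ 1`
is the bound; so every reflection-positive direction carries a Källén–Lehmann (Hausdorff moment /
Laplace) representation WITHOUT a transfer matrix. (Consumers: the nine-mirror directions of the
critical 3D Ising correlators, `CriticalCorrNineMirrorRP`.)

## References

* C. Berg, J. P. R. Christensen, P. Ressel, *Harmonic Analysis on Semigroups*, Springer GTM 100
  (1984): Ch. 4, Prop. 6.11 (Hausdorff's theorem; Hildebrandt–Schoenberg), Prop. 4.9 (bounded positive
  definite sequences), Ch. 6, §2, Thm. 2.5 (Stieltjes/Hausdorff via shifted positivity).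
  [BergChristensenRessel1984]
* F. Hausdorff, Math. Z. 9 (1921) 74–109, 280–299.
-/

noncomputable section

open MeasureTheory Set Filter Topology

namespace Literature.MeasureTheory.Integral

/-! ## 1. Moment sequences are completely monotone (the easy direction) -/

namespace HausdorffMomentTheorem

/-- On a finite measure carried by `[0,1]`, `tᵐ` is integrable (bounded by `1` a.e.). [folklore] -/
theorem integrable_pow_of_Icc {μ : Measure ℝ} [IsFiniteMeasure μ] (hμ : μ (Icc (0 : ℝ) 1)ᶜ = 0)
    (m : ℕ) : Integrable (fun t : ℝ => t ^ m) μ := by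
  refine Integrable.mono' (integrable_const (1 : ℝ)) (by fun_prop) ?_
  have hae : ∀ᵐ t ∂μ, t ∈ Icc (0 : ℝ) 1 := by
    rw [ae_iff]
    exact measure_mono_null (fun t ht => ht) hμ
  filter_upwards [hae] with t ht
  rw [Real.norm_eq_abs, abs_pow, abs_of_nonneg ht.1]
  exact pow_le_one₀ ht.1 ht.2

end HausdorffMomentTheorem

open HausdorffMomentTheorem in
/-- **Moment sequences on `[0,1]` are completely monotone**: if `a n = ∫ tⁿ dμ` for a finite
positive measure `μ` carried by `[0,1]`, then `∑_{i ≤ k} (-1)^i C(k,i) a(n+i) = ∫ tⁿ(1-t)ᵏ dμ ≥ 0`.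
[cite: BergChristensenRessel1984, Ch. 4, Prop. 6.11] -/
theorem alternating_of_hausdorffMoment (a : ℕ → ℝ) (μ : Measure ℝ) [IsFiniteMeasure μ]
    (hμ : μ (Icc (0 : ℝ) 1)ᶜ = 0) (ha : ∀ n : ℕ, a n = ∫ t, t ^ n ∂μ) (n k : ℕ) :
    0 ≤ ∑ i ∈ Finset.range (k + 1), (-1 : ℝ) ^ i * (k.choose i : ℝ) * a (n + i) := by
  have hsum : ∑ i ∈ Finset.range (k + 1), (-1 : ℝ) ^ i * (k.choose i : ℝ) * a (n + i) =
      ∫ t, t ^ n * (1 - t) ^ k ∂μ := by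
    simp_rw [ha, ← integral_const_mul]
    rw [← integral_finsetSum _ (fun i _ => (integrable_pow_of_Icc hμ (n + i)).const_mul _)]
    refine integral_congr_ae (Eventually.of_forall fun t => ?_)
    -- binomial theorem: `∑_{i ≤ k} (-1)^i C(k,i) t^{n+i} = tⁿ (1 - t)ᵏ`
    have h : (1 - t) ^ k = ∑ i ∈ Finset.range (k + 1), (-t) ^ i * 1 ^ (k - i) * (k.choose i : ℝ) := by
      rw [sub_eq_neg_add, add_pow]
    show ∑ i ∈ Finset.range (k + 1), (-1 : ℝ) ^ i * (k.choose i : ℝ) * t ^ (n + i) = t ^ n * (1 - t) ^ k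
    rw [h, Finset.mul_sum]
    refine Finset.sum_congr rfl fun i _ => ?_
    rw [one_pow, mul_one, neg_pow, pow_add]
    ring
  rw [hsum]
  refine integral_nonneg_of_ae ?_
  have hae : ∀ᵐ t ∂μ, t ∈ Icc (0 : ℝ) 1 := by
    rw [ae_iff]
    exact measure_mono_null (fun t ht => ht) hμ
  filter_upwards [hae] with t ht
  exact mul_nonneg (pow_nonneg ht.1 _) (pow_nonneg (by linarith [ht.2]) _)

/-! ## 2. Hausdorff's theorem -/

/-- **Hausdorff's moment theorem (hard direction).** A completely monotone real sequence,
`∑_{i ≤ k} (-1)^i C(k,i) a(n+i) ≥ 0` for all `n, k`, is the moment sequence of a finite positive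
measure on `[0,1]`: `a n = ∫ tⁿ dμ`. Hausdorff's construction: the Bernstein weights
`λ_{N,j} = C(N,j)(-Δ)^{N-j}a_j ≥ 0` at the nodes `j/N` have total mass `a 0`, exact
descending-factorial moments (`bernsteinWeights_sum_descFactorial`), ordinary moments tending to `a n`
(`bernsteinWeights_moment_tendsto`), and a weak cluster point (`exists_measure_of_discreteMoments_tendsto`).
[cite: BergChristensenRessel1984, Ch. 4, Prop. 6.11] -/
theorem hausdorffMoment_of_alternating (a : ℕ → ℝ)
    (hCM : ∀ n k : ℕ, 0 ≤ ∑ i ∈ Finset.range (k + 1), (-1 : ℝ) ^ i * (k.choose i : ℝ) * a (n + i)) :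
    ∃ μ : Measure ℝ, IsFiniteMeasure μ ∧ μ (Icc (0 : ℝ) 1)ᶜ = 0 ∧ ∀ n : ℕ, a n = ∫ t, t ^ n ∂μ := by
  -- the Bernstein weights
  set w : ℕ → ℕ → ℝ := fun N j => (N.choose j : ℝ) *
    ∑ i ∈ Finset.range (N - j + 1), (-1 : ℝ) ^ i * ((N - j).choose i : ℝ) * a (j + i) with hw_def
  have hw : ∀ N j, 0 ≤ w N j := fun N j => mul_nonneg (Nat.cast_nonneg _) (hCM j (N - j))
  -- total mass `a 0` (the exact identity at `n = 0`)
  have hmass : ∀ N, 1 ≤ N → ∑ j ∈ Finset.range (N + 1), w N j = a 0 := by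
    intro N _
    have h := bernsteinWeights_sum_descFactorial a N 0 (Nat.zero_le N)
    simpa only [Nat.choose_zero_right, Nat.cast_one, div_one, one_mul] using h
  -- ordinary moments converge
  have hmom : ∀ n : ℕ, Tendsto (fun N : ℕ => ∑ j ∈ Finset.range (N + 1), ((j : ℝ) / (N : ℝ)) ^ n * w N j)
      atTop (𝓝 (a n)) :=
    bernsteinWeights_moment_tendsto a hCM (fun N n hn => bernsteinWeights_sum_descFactorial a N n hn)
  exact exists_measure_of_discreteMoments_tendsto a w (a 0) hw hmass hmom

/-- **Hausdorff's moment theorem** (Hausdorff 1921; Berg–Christensen–Ressel 1984, Ch. 4, Prop. 6.11):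
a real sequence is the moment sequence of a finite positive measure on `[0,1]` iff it is completely
monotone. [cite: BergChristensenRessel1984, Ch. 4, Prop. 6.11] -/
theorem hausdorffMoment_iff_alternating (a : ℕ → ℝ) :
    (∃ μ : Measure ℝ, IsFiniteMeasure μ ∧ μ (Icc (0 : ℝ) 1)ᶜ = 0 ∧ ∀ n : ℕ, a n = ∫ t, t ^ n ∂μ) ↔
      ∀ n k : ℕ, 0 ≤ ∑ i ∈ Finset.range (k + 1), (-1 : ℝ) ^ i * (k.choose i : ℝ) * a (n + i) := by
  constructor
  · rintro ⟨μ, hfin, hμ, ha⟩ n k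
    exact alternating_of_hausdorffMoment a μ hμ ha n k
  · exact hausdorffMoment_of_alternating a

/-! ## 3. `[0,1]`-moment sequences from double Hankel positivity -/

/-- **A bounded sequence with positive semidefinite Hankel forms at shifts `0` and `1` is a Hausdorff
moment sequence** (Berg–Christensen–Ressel 1984, Ch. 4, Prop. 4.9 with Ch. 6, Thm. 2.5): if
`|a n| ≤ C`, `∑∑ cᵢcⱼ a(i+j) ≥ 0` and `∑∑ cᵢcⱼ a(i+j+1) ≥ 0` for all finitely supported real `c`, then
`a n = ∫ tⁿ dμ` for a finite positive measure `μ` on `[0,1]`. The shift contracts by Cauchy–Schwarz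
(`hankel_shift_abs_le` for `a` and for `a(·+1)`), which supplies the four square-positivities of
`hankel_alternating`; conclude by Hausdorff's theorem. This is the form reflection positivity delivers
(even / odd heights above a mirror; `|⟨σσ⟩| ≤ 1`).
[cite: BergChristensenRessel1984, Ch. 4, Prop. 4.9 and Ch. 6, Thm. 2.5] -/
theorem hausdorffMoment_of_hankel_posSemidef (a : ℕ → ℝ) (hbdd : ∃ C : ℝ, ∀ n, |a n| ≤ C)
    (hP0 : ∀ (s : Finset ℕ) (c : ℕ → ℝ), 0 ≤ ∑ i ∈ s, ∑ j ∈ s, c i * c j * a (i + j))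
    (hP1 : ∀ (s : Finset ℕ) (c : ℕ → ℝ), 0 ≤ ∑ i ∈ s, ∑ j ∈ s, c i * c j * a (i + j + 1)) :
    ∃ μ : Measure ℝ, IsFiniteMeasure μ ∧ μ (Icc (0 : ℝ) 1)ᶜ = 0 ∧ ∀ n : ℕ, a n = ∫ t, t ^ n ∂μ := by
  -- the shift contracts at level `0 → 1`
  have hP2 : ∀ (s : Finset ℕ) (c : ℕ → ℝ),
      ∑ i ∈ s, ∑ j ∈ s, c i * c j * a (i + j + 1) ≤ ∑ i ∈ s, ∑ j ∈ s, c i * c j * a (i + j) :=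
    fun s c => (le_abs_self _).trans (hankel_shift_abs_le a hbdd hP0 s c)
  -- and at level `1 → 2`: the same lemma for the shifted sequence `a(·+1)`
  have hbdd' : ∃ C : ℝ, ∀ n, |a (n + 1)| ≤ C := by
    obtain ⟨C, hC⟩ := hbdd
    exact ⟨C, fun n => hC (n + 1)⟩
  have hP0' : ∀ (s : Finset ℕ) (c : ℕ → ℝ), 0 ≤ ∑ i ∈ s, ∑ j ∈ s, c i * c j * a (i + j + 1) := hP1
  have hP2' : ∀ (s : Finset ℕ) (c : ℕ → ℝ),
      ∑ i ∈ s, ∑ j ∈ s, c i * c j * a (i + j + 2) ≤ ∑ i ∈ s, ∑ j ∈ s, c i * c j * a (i + j + 1) := by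
    intro s c
    have h := (le_abs_self _).trans (hankel_shift_abs_le (fun n => a (n + 1)) hbdd' hP0' s c)
    simpa only [add_assoc, one_add_one_eq_two] using h
  exact hausdorffMoment_of_alternating a (hankel_alternating a hP0 hP1 hP2 hP2')

end Literature.MeasureTheory.Integral
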